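import Mathlib
import Summits.Ventures.HodgeRepro2.Tier7.Line3.SplitOrbitBox

/-!
# Tier7/Line3/CosetEntryBounds — the displayed coset shape «entries ≤ u, det = δ» as a THEOREM of `K ⊆ GL₂(O)`

Filer: t7-L1-p3 (gen 9, prover-pub-hodge-repro2-t7-L1-p3-g9-0), self-selected SUPPORT row beside plan-3's layer (B)
(TWIN RULING STATUS l. 16077; TARGET line with the 10-min window). Lane: Line 3 SUPPORT, [M]-level consolidation of the
split-place row (plan-3 CONCUR l. 16101, crit-2 NO VETO l. 16103 — their docstring precisions applied); NOT a line, NOT a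
device; touches neither residual clause (a′) nor (b′) of the line.

WHAT IT SUPPLIES. SplitFactorConstants (p711068) and CoverCountLink (layer (B)) take the per-coset clause «every entry
of `t⁻¹ γ s` has value `≤ u_j`, the determinant has value `δ_j`» as the DISPLAYED shape of membership in the double
coset `K ϖ^{(m_j, n_j)} K`. This file proves that shape from the two facts it rests on:
* `K` is INTEGRAL — every element of the subgroup `K ≤ GL₂(F)` is a matrix with entries in the valuation ring
  `O = {x | v x ≤ 1}` (`IsIntegralSubgroup v K`; the model `K = GL₂(O_w)`, DoubleCosetCover's `integralSubgroup O` for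
  `O = {x | v x ≤ 1}`, is one); then every `k ∈ K` has `v (det k) = 1` (`det_eq_one_of_mem`: `k⁻¹ ∈ K` and
  `v (det k) · v (det k⁻¹) = 1` with both factors `≤ 1`);
* the representative `g` has entries of value `≤ u` and determinant of value `δ` — for the Cartan representative
  `diag(ϖ^m, ϖ^n)` these are `u = max (v ϖ^m) (v ϖ^n)` and `δ = v ϖ^m · v ϖ^n` (`diagonal_bounds`), with
  `ord u = −min m n` and `ord δ = −(m + n)` for a uniformiser `v ϖ = ofAdd (−1)` (`ord_cartan_u` / `ord_cartan_δ` —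
  intended for the Cartan hypotheses `hm` / `hn` of the count-side link, as theorems; sign convention in §D3).
Then `doubleCoset_bounds` / `doubleCoset_image_bounds`: every `x = k₁ g k₂ ∈ K g K` has entries of value `≤ u`
(`entry_mul_le`: each entry is a sum of products `k₁ i p · g p q · k₂ q l` of value `≤ 1 · u · 1`, `Valuation.map_sum_le`)
and `v (det x) = v (det k₁) · v (det g) · v (det k₂) = δ` (`det_mul_eq`) — intended for the per-coset hypothesis `hD j`
of the count-side link (layer (B), CoverCountLink — its binders are checked at (B)'s own TARGET) with
`D j := (↑) '' doubleCoset (g j) K K`; `cartan_doubleCoset_bounds` is the Cartan instance. Degenerate instances are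
consistent, not vacuous: `K = ⊥` is integral with `K g K = {g}`; the trivial valuation makes every matrix integral.
Sections: D1 integral matrices (entries and determinants under products, any value group); D2 integral subgroups and
the double-coset bounds; D3 the Cartan datum in `ord` (discrete valuation, uniformiser).

WHAT STAYS IN WORDS (the dictionary, (a′)): that the real `K_w = GL₂(O_w)` IS `integralSubgroup (v.integer)`; that the
finite cover of `U = supp f_w` by double cosets (DoubleCosetCover's `exists_finset_doubleCoset_cover`, for `U` compact and
`K` open) has CARTAN representatives `diag(ϖ^{m_j}, ϖ^{n_j})` — the Cartan decomposition `K\GL₂(F_w)/K ≅ {(m, n) : m ≥ n}`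
(the elementary-divisor theorem of the DVR, NOT in this row); the place datum. Nothing here is about (N), (P), the
real `X`, or HC_CM. §8(d): NO. Blind lane: Mathlib + the HodgeRepro2 prefix; no sorry;
axioms ⊆ {propext, Classical.choice, Quot.sound}.
-/

namespace Summit.Ventures.HodgeRepro2.Tier7.Line3.CosetEntryBounds

open Matrix Summit.Ventures.HodgeRepro2.Tier7.Line3.SplitOrbitBox

/-! ## D1. Integral matrices: entries and determinants under products -/

section Entries

variable {F : Type*} [Field F] {Γ₀ : Type*} [LinearOrderedCommGroupWithZero Γ₀]

/-- **an integral matrix**: every entry has value `≤ 1` (the entries lie in the valuation ring `O = {x | v x ≤ 1}`). -/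
def IsIntegral (v : Valuation F Γ₀) (k : Matrix (Fin 2) (Fin 2) F) : Prop := ∀ i l, v (k i l) ≤ 1

/-- a product of integral matrices is integral. -/
theorem IsIntegral.mul (v : Valuation F Γ₀) {k₁ k₂ : Matrix (Fin 2) (Fin 2) F} (h₁ : IsIntegral v k₁)
    (h₂ : IsIntegral v k₂) : IsIntegral v (k₁ * k₂) := by
  intro i l
  rw [Matrix.mul_apply]
  refine Valuation.map_sum_le v fun p _ => ?_
  rw [Valuation.map_mul]
  calc v (k₁ i p) * v (k₂ p l) ≤ 1 * 1 := mul_le_mul' (h₁ i p) (h₂ p l)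
    _ = 1 := one_mul 1

/-- **entries of a product `k₁ · M · k₂` with integral outer factors**: if every entry of `M` has value `≤ u`, so has
every entry of `k₁ · M · k₂` (a sum of products `k₁ i p · M p q · k₂ q l`, each of value `≤ 1 · u · 1`). -/
theorem entry_mul_le (v : Valuation F Γ₀) {k₁ M k₂ : Matrix (Fin 2) (Fin 2) F}
    (hk₁ : IsIntegral v k₁) (hk₂ : IsIntegral v k₂) {u : Γ₀} (hM : ∀ i l, v (M i l) ≤ u) (i l : Fin 2) :
    v ((k₁ * M * k₂) i l) ≤ u := by
  rw [Matrix.mul_apply]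
  refine Valuation.map_sum_le v fun q _ => ?_
  rw [Valuation.map_mul, Matrix.mul_apply]
  have h1 : v (∑ p, k₁ i p * M p q) ≤ u := by
    refine Valuation.map_sum_le v fun p _ => ?_
    rw [Valuation.map_mul]
    calc v (k₁ i p) * v (M p q) ≤ 1 * u := mul_le_mul' (hk₁ i p) (hM p q)
      _ = u := one_mul u
  calc v (∑ p, k₁ i p * M p q) * v (k₂ q l) ≤ u * 1 := mul_le_mul' h1 (hk₂ q l)
    _ = u := mul_one u

/-- the determinant of an integral `2 × 2` matrix has value `≤ 1`. -/
theorem det_le_one (v : Valuation F Γ₀) {k : Matrix (Fin 2) (Fin 2) F} (hk : IsIntegral v k) : v k.det ≤ 1 := by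
  rw [Matrix.det_fin_two]
  refine (Valuation.map_sub v _ _).trans (max_le ?_ ?_)
  · rw [Valuation.map_mul]
    calc v (k 0 0) * v (k 1 1) ≤ 1 * 1 := mul_le_mul' (hk 0 0) (hk 1 1)
      _ = 1 := one_mul 1
  · rw [Valuation.map_mul]
    calc v (k 0 1) * v (k 1 0) ≤ 1 * 1 := mul_le_mul' (hk 0 1) (hk 1 0)
      _ = 1 := one_mul 1

/-- **the determinant of an integral matrix with an integral inverse is a unit**: `v (det k) = 1`
(`v (det k) · v (det k') = v (det (k k')) = 1` with both factors `≤ 1`). -/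
theorem det_eq_one_of_integral (v : Valuation F Γ₀) {k k' : Matrix (Fin 2) (Fin 2) F} (hk : IsIntegral v k)
    (hk' : IsIntegral v k') (hkk' : k * k' = 1) : v k.det = 1 := by
  have h1 : v k.det * v k'.det = 1 := by
    rw [← Valuation.map_mul, ← Matrix.det_mul, hkk', Matrix.det_one, Valuation.map_one]
  have h2 := det_le_one v hk
  have h3 := det_le_one v hk'
  by_contra hne
  have hlt : v k.det < 1 := lt_of_le_of_ne h2 hne
  have h4 : v k.det * v k'.det ≤ v k.det := by
    calc v k.det * v k'.det ≤ v k.det * 1 := mul_le_mul' le_rfl h3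
      _ = v k.det := mul_one _
  rw [h1] at h4
  exact absurd h4 (not_le.2 hlt)

/-- the determinant of `k₁ · M · k₂` has the value of `det M` when the outer factors have unit determinants. -/
theorem det_mul_eq (v : Valuation F Γ₀) {k₁ M k₂ : Matrix (Fin 2) (Fin 2) F} (h₁ : v k₁.det = 1)
    (h₂ : v k₂.det = 1) : v (k₁ * M * k₂).det = v M.det := by
  rw [Matrix.det_mul, Matrix.det_mul, Valuation.map_mul, Valuation.map_mul, h₁, h₂, one_mul, mul_one]

end Entries

/-! ## D2. The displayed coset shape as a theorem of `K ⊆ GL₂(O)` -/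

section Coset

variable {F : Type*} [Field F] {Γ₀ : Type*} [LinearOrderedCommGroupWithZero Γ₀]

/-- **an integral subgroup** `K ≤ GL₂(F)`: every element is an integral matrix (then so is every inverse, `K` being a
subgroup — the model `K = GL₂(O)`; DoubleCosetCover's `integralSubgroup O` for `O = {x | v x ≤ 1}` is one). -/
def IsIntegralSubgroup (v : Valuation F Γ₀) (K : Subgroup (GL (Fin 2) F)) : Prop :=
  ∀ k ∈ K, IsIntegral v (k : Matrix (Fin 2) (Fin 2) F)

/-- every element of an integral subgroup has a determinant of value `1` (`det_eq_one_of_integral` with the matrix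
identity `↑k * ↑(k⁻¹) = 1` from `Units.mul_inv`; `k⁻¹ ∈ K` is integral since `K` is a subgroup). -/
theorem det_eq_one_of_mem (v : Valuation F Γ₀) {K : Subgroup (GL (Fin 2) F)} (hK : IsIntegralSubgroup v K)
    {k : GL (Fin 2) F} (hk : k ∈ K) : v (k : Matrix (Fin 2) (Fin 2) F).det = 1 :=
  det_eq_one_of_integral v (hK k hk) (hK k⁻¹ (K.inv_mem hk)) (by
    rw [← Units.val_mul, mul_inv_cancel, Units.val_one])

/-- **THE DISPLAYED COSET SHAPE IS A THEOREM**: for `K` integral and a representative `g` whose entries have value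
`≤ u` and whose determinant has value `δ`, every element of the double coset `K g K` has entries of value `≤ u` and
determinant of value `δ` — intended for the per-coset hypothesis `hD` of the count-side link (layer (B), CoverCountLink)
with `D = K g K`. -/
theorem doubleCoset_bounds (v : Valuation F Γ₀) {K : Subgroup (GL (Fin 2) F)} (hK : IsIntegralSubgroup v K)
    (g : GL (Fin 2) F) (u δ : Γ₀) (hg : ∀ i l, v ((g : Matrix (Fin 2) (Fin 2) F) i l) ≤ u)
    (hgdet : v (g : Matrix (Fin 2) (Fin 2) F).det = δ) :
    ∀ x ∈ DoubleCoset.doubleCoset g (K : Set (GL (Fin 2) F)) K,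
      (∀ i l, v ((x : Matrix (Fin 2) (Fin 2) F) i l) ≤ u) ∧ v (x : Matrix (Fin 2) (Fin 2) F).det = δ := by
  intro x hx
  obtain ⟨k₁, hk₁, k₂, hk₂, rfl⟩ := DoubleCoset.mem_doubleCoset.1 hx
  have e : ((k₁ * g * k₂ : GL (Fin 2) F) : Matrix (Fin 2) (Fin 2) F) =
      (k₁ : Matrix (Fin 2) (Fin 2) F) * (g : Matrix (Fin 2) (Fin 2) F) * (k₂ : Matrix (Fin 2) (Fin 2) F) := by
    rw [Units.val_mul, Units.val_mul]
  rw [e]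
  exact ⟨entry_mul_le v (hK k₁ hk₁) (hK k₂ hk₂) hg,
    by rw [det_mul_eq v (det_eq_one_of_mem v hK hk₁) (det_eq_one_of_mem v hK hk₂), hgdet]⟩

/-- the same, on the IMAGE of the double coset in the matrices (the shape intended for the pieces `D j` of the
count-side link). -/
theorem doubleCoset_image_bounds (v : Valuation F Γ₀) {K : Subgroup (GL (Fin 2) F)} (hK : IsIntegralSubgroup v K)
    (g : GL (Fin 2) F) (u δ : Γ₀) (hg : ∀ i l, v ((g : Matrix (Fin 2) (Fin 2) F) i l) ≤ u)
    (hgdet : v (g : Matrix (Fin 2) (Fin 2) F).det = δ) :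
    ∀ M ∈ (fun x : GL (Fin 2) F => (x : Matrix (Fin 2) (Fin 2) F)) ''
        DoubleCoset.doubleCoset g (K : Set (GL (Fin 2) F)) K,
      (∀ i l, v (M i l) ≤ u) ∧ v M.det = δ := by
  rintro _ ⟨x, hx, rfl⟩
  exact doubleCoset_bounds v hK g u δ hg hgdet x hx

/-- **the diagonal representative**: `g = diag(x, y)` has entries of value `≤ max (v x) (v y)` and determinant of
value `v x · v y`. -/
theorem diagonal_bounds (v : Valuation F Γ₀) (x y : F) :
    (∀ i l, v ((diagonal ![x, y] : Matrix (Fin 2) (Fin 2) F) i l) ≤ max (v x) (v y)) ∧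
      v (diagonal ![x, y] : Matrix (Fin 2) (Fin 2) F).det = v x * v y := by
  refine ⟨fun i l => ?_, ?_⟩
  · fin_cases i <;> fin_cases l <;> simp [diagonal]
  · rw [Matrix.det_diagonal, Fin.prod_univ_two, Valuation.map_mul]
    simp

end Coset

/-! ## D3. The Cartan datum in `ord`: `u = ϖ^{min(m,n)}`, `δ = ϖ^{m+n}`

SIGN CONVENTION (crit-2 l. 16103 (i)): the uniformiser has `v ϖ = ofAdd (−1)`, so for `x ≠ 0` x1's
`ord (v x) = toAdd (unzero (v x))` is the NEGATIVE of the usual `ϖ`-adic order of `x` (`ord (v ϖ) = −1`,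
`ord (v (ϖ ^ m)) = −m`), exactly SplitOrbitBox's / SplitFactorConstants' convention; «entries of value `≤ u = max (v ϖ^m) (v ϖ^n)`»
means «entries in `ϖ^{min m n} O`», and `ord u = −min m n` is the negative of the usual additive valuation of the coset's
minimum. The slack box of the count-side link (`ord lo ≤ … ≤ ord hi`) is read in the same convention, so the two compose
without a sign flip. -/

section Cartan

open WithZero Multiplicative

variable {F : Type*} [Field F]

/-- `ord (↑(ofAdd k)) = k` (the additive order of a coerced value). -/
theorem ord_coe_ofAdd (k : ℤ) :
    ord (show ((Multiplicative.ofAdd k : Multiplicative ℤ) : WithZero (Multiplicative ℤ)) ≠ 0 from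
      WithZero.coe_ne_zero) = k := by
  unfold ord
  rw [unzero_coe, toAdd_ofAdd]

/-- the value of `ϖ^m` for a uniformiser (`v ϖ = ofAdd (−1)`): `v (ϖ ^ m) = ofAdd (−m)`. -/
theorem val_zpow_uniformiser (v : Valuation F (WithZero (Multiplicative ℤ))) (ϖ : F)
    (hϖ : v ϖ = ((Multiplicative.ofAdd (-1 : ℤ) : Multiplicative ℤ) : WithZero (Multiplicative ℤ))) (m : ℤ) :
    v (ϖ ^ m) = ((Multiplicative.ofAdd (-m) : Multiplicative ℤ) : WithZero (Multiplicative ℤ)) := by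
  rw [map_zpow₀, hϖ, ← WithZero.coe_zpow, ← ofAdd_zsmul, smul_neg, smul_eq_mul, mul_one]

/-- `v (ϖ ^ m) ≠ 0` for a uniformiser. -/
theorem val_zpow_ne_zero (v : Valuation F (WithZero (Multiplicative ℤ))) (ϖ : F)
    (hϖ : v ϖ = ((Multiplicative.ofAdd (-1 : ℤ) : Multiplicative ℤ) : WithZero (Multiplicative ℤ))) (m : ℤ) :
    v (ϖ ^ m) ≠ 0 := by
  rw [val_zpow_uniformiser v ϖ hϖ m]
  exact WithZero.coe_ne_zero

/-- `max (v ϖ^m) (v ϖ^n) = ofAdd (−min m n)`. -/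
theorem max_val_zpow (v : Valuation F (WithZero (Multiplicative ℤ))) (ϖ : F)
    (hϖ : v ϖ = ((Multiplicative.ofAdd (-1 : ℤ) : Multiplicative ℤ) : WithZero (Multiplicative ℤ))) (m n : ℤ) :
    max (v (ϖ ^ m)) (v (ϖ ^ n)) =
      ((Multiplicative.ofAdd (-min m n) : Multiplicative ℤ) : WithZero (Multiplicative ℤ)) := by
  rw [val_zpow_uniformiser v ϖ hϖ m, val_zpow_uniformiser v ϖ hϖ n]
  rcases le_total m n with h | h
  · rw [min_eq_left h, max_eq_left]
    rw [WithZero.coe_le_coe, Multiplicative.ofAdd_le]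
    linarith
  · rw [min_eq_right h, max_eq_right]
    rw [WithZero.coe_le_coe, Multiplicative.ofAdd_le]
    linarith

/-- `v ϖ^m · v ϖ^n = ofAdd (−(m + n))`. -/
theorem mul_val_zpow (v : Valuation F (WithZero (Multiplicative ℤ))) (ϖ : F)
    (hϖ : v ϖ = ((Multiplicative.ofAdd (-1 : ℤ) : Multiplicative ℤ) : WithZero (Multiplicative ℤ))) (m n : ℤ) :
    v (ϖ ^ m) * v (ϖ ^ n) =
      ((Multiplicative.ofAdd (-(m + n)) : Multiplicative ℤ) : WithZero (Multiplicative ℤ)) := by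
  rw [val_zpow_uniformiser v ϖ hϖ m, val_zpow_uniformiser v ϖ hϖ n, ← WithZero.coe_mul, ← ofAdd_add, neg_add]

/-- the Cartan slack `u = max (v ϖ^m) (v ϖ^n)` is non-zero. -/
theorem cartan_u_ne_zero (v : Valuation F (WithZero (Multiplicative ℤ))) (ϖ : F)
    (hϖ : v ϖ = ((Multiplicative.ofAdd (-1 : ℤ) : Multiplicative ℤ) : WithZero (Multiplicative ℤ))) (m n : ℤ) :
    max (v (ϖ ^ m)) (v (ϖ ^ n)) ≠ 0 := by
  rw [max_val_zpow v ϖ hϖ m n]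
  exact WithZero.coe_ne_zero

/-- the Cartan determinant value `δ = v ϖ^m · v ϖ^n` is non-zero. -/
theorem cartan_δ_ne_zero (v : Valuation F (WithZero (Multiplicative ℤ))) (ϖ : F)
    (hϖ : v ϖ = ((Multiplicative.ofAdd (-1 : ℤ) : Multiplicative ℤ) : WithZero (Multiplicative ℤ))) (m n : ℤ) :
    v (ϖ ^ m) * v (ϖ ^ n) ≠ 0 := by
  rw [mul_val_zpow v ϖ hϖ m n]
  exact WithZero.coe_ne_zero

/-- **the Cartan datum of `diag(ϖ^m, ϖ^n)` in `ord`**: `ord u = −min m n` (intended for the Cartan hypothesis `hm` of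
the count-side link, as a theorem). -/
theorem ord_cartan_u (v : Valuation F (WithZero (Multiplicative ℤ))) (ϖ : F)
    (hϖ : v ϖ = ((Multiplicative.ofAdd (-1 : ℤ) : Multiplicative ℤ) : WithZero (Multiplicative ℤ))) (m n : ℤ)
    (hu : max (v (ϖ ^ m)) (v (ϖ ^ n)) ≠ 0) : ord hu = -min m n := by
  have h : ord hu = ord (show ((Multiplicative.ofAdd (-min m n) : Multiplicative ℤ) :
      WithZero (Multiplicative ℤ)) ≠ 0 from WithZero.coe_ne_zero) := by
    unfold ord; congr 1; simp_rw [max_val_zpow v ϖ hϖ m n]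
  rw [h, ord_coe_ofAdd]

/-- **the Cartan datum of `diag(ϖ^m, ϖ^n)` in `ord`**: `ord δ = −(m + n)` (intended for the Cartan hypothesis `hn` of
the count-side link, as a theorem). -/
theorem ord_cartan_δ (v : Valuation F (WithZero (Multiplicative ℤ))) (ϖ : F)
    (hϖ : v ϖ = ((Multiplicative.ofAdd (-1 : ℤ) : Multiplicative ℤ) : WithZero (Multiplicative ℤ))) (m n : ℤ)
    (hδ : v (ϖ ^ m) * v (ϖ ^ n) ≠ 0) : ord hδ = -(m + n) := by
  have h : ord hδ = ord (show ((Multiplicative.ofAdd (-(m + n)) : Multiplicative ℤ) :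
      WithZero (Multiplicative ℤ)) ≠ 0 from WithZero.coe_ne_zero) := by
    unfold ord; congr 1; simp_rw [mul_val_zpow v ϖ hϖ m n]
  rw [h, ord_coe_ofAdd]

/-- **THE CARTAN COSET IS A THEOREM OF ITS DATUM**: for `K` integral and a representative `g` with matrix
`diag(ϖ^m, ϖ^n)`, every matrix in the image of `K g K` has entries of value `≤ u := max (v ϖ^m) (v ϖ^n)`
and determinant of value `δ := v ϖ^m · v ϖ^n` (for a uniformiser `ϖ`, `ord u = −min m n` and `ord δ = −(m + n)` by
`ord_cartan_u` / `ord_cartan_δ`) — intended for the per-coset hypothesis `hD` of the count-side link at the Cartan cover. -/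
theorem cartan_doubleCoset_bounds (v : Valuation F (WithZero (Multiplicative ℤ))) (ϖ : F)
    {K : Subgroup (GL (Fin 2) F)} (hK : IsIntegralSubgroup v K) (g : GL (Fin 2) F) (m n : ℤ)
    (hg : (g : Matrix (Fin 2) (Fin 2) F) = diagonal ![ϖ ^ m, ϖ ^ n]) :
    ∀ M ∈ (fun x : GL (Fin 2) F => (x : Matrix (Fin 2) (Fin 2) F)) ''
        DoubleCoset.doubleCoset g (K : Set (GL (Fin 2) F)) K,
      (∀ i l, v (M i l) ≤ max (v (ϖ ^ m)) (v (ϖ ^ n))) ∧ v M.det = v (ϖ ^ m) * v (ϖ ^ n) := by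
  obtain ⟨h1, h2⟩ := diagonal_bounds v (ϖ ^ m) (ϖ ^ n)
  exact doubleCoset_image_bounds v hK g _ _ (by rw [hg]; exact h1) (by rw [hg]; exact h2)

end Cartan

end Summit.Ventures.HodgeRepro2.Tier7.Line3.CosetEntryBounds
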